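import Summits.HodgeConjecture.CorCM.AbelianSixteenSimpleEightfoldsExist
import Summits.HodgeConjecture.CorCM.AbelianTwoPowerCMTypesWeilType
import HarnessLib

/-!
# The three remaining abelian Galois types of degree `16` — `ℤ/4 × ℤ/4`, and `ℤ/4 × (ℤ/2)²` with complex conjugation
# not a square — carry simple DEGENERATE CM abelian eightfolds: the classification of abelian CM fields of degree `16`

COR-CM (cell `pub-hodgecm2`), binder seat b04 (gen 15), count-neutral claim ABELIAN-2POWER-CLASSIF, part VI.  KERNEL
ONLY: theorems; no definition, no named fact, no `sorry`.  `HC_CM` is neither used nor claimed.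

* §1 **`exists_isPrimitive_not_isNondegenerate_of_balancedModel`** — GENERIC (sequel of part V's
  `exists_isPrimitive_of_galoisModel`): an isomorphism `e : Gal(K/ℚ) ≃ M` (`c ↦ c₀`), a model `T₀ ⊆ M` (CM set for
  `c₀`, trivial stabiliser) and an additive map `f : M → N` with `f(c₀) ≠ 0` over whose fibres `T₀` is BALANCED give a
  PRIMITIVE CM type of `K` balanced over the subfield `k = K^{ker(f ∘ e)}` (which has a complex place), hence
  DEGENERATE by Yanai's `a = b` (`Pohlmann1968.not_isNondegenerate_of_fibres_balanced`).
* §2 three kernel-decided models: on `ℤ/4 × ℤ/4` (`c₀ = (2,0)`, `f = pr₁`, type `{0}×{0,1} ∪ {1}×{0,2} ∪ {2}×{2,3} ∪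
  {3}×{1,3}`), on `ℤ/4 × (ℤ/2)²` with `c₀ = (0,1,0)` and with `c₀ = (2,1,0)` (`f = pr₂`, balanced `(4,4)` over the
  index-`2` kernel `{y = 0} ≅ ℤ/4 × ℤ/2`, from the aperiodic non-self-complementary half `{(0,0),(1,0),(2,0),(0,1)}`).
* §3 **`exists_simple_degenerate_of_equiv_zmod4_sq`**, **`…_of_equiv_zmod4_prod_zmod2_sq_conj_snd`**,
  **`…_conj_mixed`**: for `K` CM Galois of degree `16` of these three Galois types there is a PRIMITIVE DEGENERATE CM
  type, realised (Shimura, tree `cmAbelianVarietyRealised_holds`) by a SIMPLE CM abelian eightfold carrying an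
  exceptional Hodge class on some power.

THE CLASSIFICATION OF ABELIAN CM FIELDS OF DEGREE `16` (the nine pairs `(Gal(K/ℚ), c)` up to automorphism):
every simple CM abelian eightfold with CM by `K` is nondegenerate (`Hdg = Div` on all powers, HC for all powers)
**iff** `(Gal, c)` is one of `ℤ/16` (gen 11 `CyclicTwoPower`), `(ℤ/8 × ℤ/2, (4,0))` (parts Ib/V), `((ℤ/2)⁴, ·)`,
`(ℤ/4 × (ℤ/2)², (2,0,0))` (parts IIc/V); for the other five — `(ℤ/8 × ℤ/2, (0,1))`, `(ℤ/8 × ℤ/2, (4,1))` (part IIIb: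
cyclic over an imaginary quadratic field), `(ℤ/4 × ℤ/4, ·)`, `(ℤ/4 × (ℤ/2)², (0,1,0))`, `(ℤ/4 × (ℤ/2)², (2,1,0))`
(this file) — simple DEGENERATE CM eightfolds exist.  (Counts of primitive degenerate types, offline census of this
seat: `96, 96, 64, 64, 64`.)

## References

* [Shimura1998] G. Shimura, *Abelian Varieties with Complex Multiplication and Modular Functions*, §6.2 Thm. 3,
  §8.1, §8.2 Prop. 26, §18.2 Lemma.
* [Gordon1999HodgeAVSurvey] B. B. Gordon, *A survey of the Hodge conjecture for abelian varieties*, §9.4.2, §9.4.3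
  (Theorem [B.140] = Yanai 1994), Thm. 6.4.
* [Pohlmann1968] H. Pohlmann, Ann. of Math. 88 (1968), Thm. 1, §3.
-/

noncomputable section

open CategoryTheory CategoryTheory.Limits NumberField

namespace Summit.HodgeConjecture.CorCM.AbelianSixteen

open Literature.NumberTheory.ComplexMultiplication
open Literature.AlgebraicGeometry.Motives (AbelianVariety CMType)
open Literature.AlgebraicGeometry.HodgeTheory
open Literature.AlgebraicGeometry.ComplexMultiplication (IsCMTypeRealisation isSimple_iff_isPrimitive
  exists_isCMTypeRealisation_of_realised)
open Literature.AlgebraicGeometry.Pohlmann1968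
open Literature.Barriers.HodgeConjecture (divisorClassesSpan)
open Summit.HodgeConjecture.CorCM.GaloisOctic (embOf_complexConj_mul exists_embOf_comp_algebraMap_eq)
open Summit.HodgeConjecture.CorCM.AbelianTwoPower (embOf_comp_eq_iff)

open scoped Classical

variable {K : Type} [Field K] [NumberField K] [IsCMField K]

/-! ## §1 Balanced Galois models ⟹ primitive degenerate CM types -/

/-- **A balanced model gives a PRIMITIVE DEGENERATE CM type.**  `K/ℚ` Galois CM, `e : Gal(K/ℚ) ≃ M` with `c ↦ c₀`,
`T₀ ⊆ M` a CM set for `c₀` with trivial stabiliser, `f : M →+ N` with `f(c₀) ≠ 0` such that on every fibre of `f`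
exactly half of the points lie in `T₀`.  Then the primitive CM type `Φ = {σ_g : e(g) ∈ T₀}` is balanced over the
fixed field `k` of `ker(f ∘ e)` — a subfield with a complex place (`c ∉ ker`) — and therefore degenerate.
[cite: Gordon1999HodgeAVSurvey, §9.4.3 (Theorem [B.140])] [cite: Shimura1998, §8.1, §8.2 Prop. 26] -/
theorem exists_isPrimitive_not_isNondegenerate_of_balancedModel [IsGalois ℚ K] {M N : Type*} [AddCommGroup M]
    [Fintype M] [DecidableEq M] [AddCommGroup N] [DecidableEq N] (e : (K ≃ₐ[ℚ] K) ≃* Multiplicative M) (c₀ : M)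
    (hc : e ((IsCMField.complexConj K).restrictScalars ℚ) = Multiplicative.ofAdd c₀) (T₀ : Finset M)
    (hcm : ∀ x : M, x ∈ T₀ ↔ c₀ + x ∉ T₀) (hprim : ∀ v : M, v ≠ 0 → ∃ w : M, ¬ (w ∈ T₀ ↔ v + w ∈ T₀))
    (f : M →+ N) (hfc : f c₀ ≠ 0)
    (hbal : ∀ x : M, (Finset.univ.filter fun h : M => f h = f x ∧ h ∈ T₀).card =
      (Finset.univ.filter fun h : M => f h = f x ∧ h ∉ T₀).card) (φ₀ : K →+* ℂ) :
    ∃ Φ : CMType K, IsPrimitive (ℂ ≃+* ℂ) Φ.1 φ₀ ∧ ¬ IsNondegenerate Φ := by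
  obtain ⟨Φ, hΦprim, hmem⟩ := exists_isPrimitive_of_galoisModel e c₀ hc T₀ hcm hprim φ₀
  refine ⟨Φ, hΦprim, ?_⟩
  set c : K ≃ₐ[ℚ] K := (IsCMField.complexConj K).restrictScalars ℚ with hc_def
  -- the subgroup `H = ker (f ∘ e)` and its fixed field `k`
  set xOf : (K ≃ₐ[ℚ] K) → M := fun g => Multiplicative.toAdd (e g) with hxOf
  have hxmul : ∀ g h : K ≃ₐ[ℚ] K, xOf (g * h) = xOf g + xOf h := fun g h => by
    simp only [hxOf, map_mul, toAdd_mul]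
  have hxinv : ∀ g : K ≃ₐ[ℚ] K, xOf g⁻¹ = -xOf g := fun g => by simp only [hxOf, map_inv, toAdd_inv]
  have hxc : xOf c = c₀ := by simp only [hxOf, hc, toAdd_ofAdd]
  obtain ⟨H, hH⟩ : ∃ H : Subgroup (K ≃ₐ[ℚ] K), ∀ g, g ∈ H ↔ f (xOf g) = 0 :=
    ⟨{ carrier := {g | f (xOf g) = 0}
       mul_mem' := fun {a b} ha hb => by
         simp only [Set.mem_setOf_eq] at ha hb ⊢
         rw [hxmul, map_add, ha, hb, add_zero]
       one_mem' := by simp only [Set.mem_setOf_eq, hxOf, map_one, toAdd_one, map_zero]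
       inv_mem' := fun {a} ha => by
         simp only [Set.mem_setOf_eq] at ha ⊢
         rw [hxinv, map_neg, ha, neg_zero] }, fun _ => Iff.rfl⟩
  set k : IntermediateField ℚ K := IntermediateField.fixedField H with hk
  set j : k →+* K := algebraMap k K with hj
  -- restriction to `k`: `σ_g|_k = σ_{g'}|_k ↔ f (x_g) = f (x_{g'})`
  have hres : ∀ g g' : K ≃ₐ[ℚ] K, (embOf φ₀ g).comp j = (embOf φ₀ g').comp j ↔ f (xOf g) = f (xOf g') := by
    intro g g'
    rw [hj, hk, embOf_comp_eq_iff φ₀ H g g', hH, hxmul, hxinv, map_add, map_neg, add_neg_eq_zero, eq_comm]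
  -- `k` has a complex place: `conj ∘ σ_1 = σ_c` differs from `σ_1` on `k`
  have hk_cx : ComplexEmbedding.conjugate ((embOf φ₀ 1).comp j) ≠ (embOf φ₀ 1).comp j := by
    intro h
    have h' : (embOf φ₀ (c * 1)).comp j = (embOf φ₀ 1).comp j := by
      rw [embOf_complexConj_mul]; exact h
    rw [hres, mul_one, hxc, hxOf] at h'
    simp only [map_one, toAdd_one, map_zero] at h'
    exact hfc h'
  -- the fibres over `k` are balanced
  have hW : ∀ τ : k →+* ℂ, {φ : K →+* ℂ | φ.comp j = τ ∧ φ ∈ Φ.1}.ncard =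
      {φ : K →+* ℂ | φ.comp j = τ ∧ φ ∉ Φ.1}.ncard := by
    intro τ
    obtain ⟨g₀, hg₀⟩ := exists_embOf_comp_algebraMap_eq φ₀ k τ
    -- transport along the bijection `x ↦ σ_{e⁻¹ x}`
    set E : M → (K →+* ℂ) := fun x => embOf φ₀ (e.symm (Multiplicative.ofAdd x)) with hE
    have hxE : ∀ x, xOf (e.symm (Multiplicative.ofAdd x)) = x := fun x => by
      simp only [hxOf, MulEquiv.apply_symm_apply, toAdd_ofAdd]
    have hEx : ∀ g, E (xOf g) = embOf φ₀ g := fun g => by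
      simp only [hE, hxOf, ofAdd_toAdd, MulEquiv.symm_apply_apply]
    have hEinj : Function.Injective E := fun x y hxy => by
      have h1 := (embOf_bijective φ₀).1 hxy
      have h2 := congrArg xOf h1
      rwa [hxE, hxE] at h2
    have hfib : ∀ P : (K →+* ℂ) → Prop, {φ : K →+* ℂ | φ.comp j = τ ∧ P φ} =
        E '' ↑(Finset.univ.filter fun x : M => f x = f (xOf g₀) ∧ P (E x)) := by
      intro P
      ext φ
      simp only [Set.mem_setOf_eq, Set.mem_image, Finset.coe_filter, Finset.mem_univ, true_and]
      constructor
      · rintro ⟨hφ, hP⟩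
        obtain ⟨g, rfl⟩ := (embOf_bijective φ₀).2 φ
        refine ⟨xOf g, ⟨?_, by rw [hEx]; exact hP⟩, hEx g⟩
        exact ((hres g g₀).1 (hφ.trans hg₀.symm))
      · rintro ⟨x, ⟨hx, hP⟩, rfl⟩
        refine ⟨?_, hP⟩
        rw [← hg₀, hE]
        exact (hres _ g₀).2 (by rw [hxE]; exact hx)
    have hmemE : ∀ x, E x ∈ Φ.1 ↔ x ∈ T₀ := fun x => by
      rw [hE]
      simp only
      rw [hmem, MulEquiv.apply_symm_apply, toAdd_ofAdd]
    rw [hfib (fun φ => φ ∈ Φ.1), hfib (fun φ => φ ∉ Φ.1), Set.ncard_image_of_injective _ hEinj,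
      Set.ncard_image_of_injective _ hEinj, Set.ncard_coe_finset, Set.ncard_coe_finset]
    convert hbal (xOf g₀) using 4 <;> simp only [hmemE]
  exact not_isNondegenerate_of_fibres_balanced j hW hk_cx

/-! ## §2 The three balanced models (kernel-decided) -/

namespace Models

/-- `ℤ/4 × ℤ/4`, `c₀ = (2,0)`: CM set. [folklore] -/
theorem cm44 : ∀ x : ZMod 4 × ZMod 4,
    x ∈ ({(0,0), (0,1), (1,0), (1,2), (2,2), (2,3), (3,1), (3,3)} : Finset (ZMod 4 × ZMod 4)) ↔
      (2, 0) + x ∉ ({(0,0), (0,1), (1,0), (1,2), (2,2), (2,3), (3,1), (3,3)} : Finset (ZMod 4 × ZMod 4)) := by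
  decide

/-- `ℤ/4 × ℤ/4`: trivial stabiliser. [folklore] -/
theorem prim44 : ∀ v : ZMod 4 × ZMod 4, v ≠ 0 → ∃ w : ZMod 4 × ZMod 4,
    ¬ (w ∈ ({(0,0), (0,1), (1,0), (1,2), (2,2), (2,3), (3,1), (3,3)} : Finset (ZMod 4 × ZMod 4)) ↔
      v + w ∈ ({(0,0), (0,1), (1,0), (1,2), (2,2), (2,3), (3,1), (3,3)} : Finset (ZMod 4 × ZMod 4))) := by
  decide

/-- `ℤ/4 × ℤ/4`: balanced over the fibres of the first projection. [folklore] -/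
theorem bal44 : ∀ x : ZMod 4 × ZMod 4,
    (Finset.univ.filter fun h : ZMod 4 × ZMod 4 => (AddMonoidHom.fst (ZMod 4) (ZMod 4)) h =
        (AddMonoidHom.fst (ZMod 4) (ZMod 4)) x ∧
      h ∈ ({(0,0), (0,1), (1,0), (1,2), (2,2), (2,3), (3,1), (3,3)} : Finset (ZMod 4 × ZMod 4))).card =
    (Finset.univ.filter fun h : ZMod 4 × ZMod 4 => (AddMonoidHom.fst (ZMod 4) (ZMod 4)) h =
        (AddMonoidHom.fst (ZMod 4) (ZMod 4)) x ∧
      h ∉ ({(0,0), (0,1), (1,0), (1,2), (2,2), (2,3), (3,1), (3,3)} : Finset (ZMod 4 × ZMod 4))).card := by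
  decide

/-- `ℤ/4 × (ℤ/2)²`, `c₀ = (0,1,0)`: CM set. [folklore] -/
theorem cm422a : ∀ x : ZMod 4 × ZMod 2 × ZMod 2,
    x ∈ ({(0,0,0), (1,0,0), (2,0,0), (0,0,1), (3,1,0), (1,1,1), (2,1,1), (3,1,1)} :
      Finset (ZMod 4 × ZMod 2 × ZMod 2)) ↔
      (0, 1, 0) + x ∉ ({(0,0,0), (1,0,0), (2,0,0), (0,0,1), (3,1,0), (1,1,1), (2,1,1), (3,1,1)} :
      Finset (ZMod 4 × ZMod 2 × ZMod 2)) := by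
  decide

/-- `ℤ/4 × (ℤ/2)²`, `c₀ = (0,1,0)`: trivial stabiliser. [folklore] -/
theorem prim422a : ∀ v : ZMod 4 × ZMod 2 × ZMod 2, v ≠ 0 → ∃ w : ZMod 4 × ZMod 2 × ZMod 2,
    ¬ (w ∈ ({(0,0,0), (1,0,0), (2,0,0), (0,0,1), (3,1,0), (1,1,1), (2,1,1), (3,1,1)} :
      Finset (ZMod 4 × ZMod 2 × ZMod 2)) ↔
      v + w ∈ ({(0,0,0), (1,0,0), (2,0,0), (0,0,1), (3,1,0), (1,1,1), (2,1,1), (3,1,1)} :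
      Finset (ZMod 4 × ZMod 2 × ZMod 2))) := by
  decide

/-- `ℤ/4 × (ℤ/2)²`, `c₀ = (0,1,0)`: balanced `(4,4)` over the fibres of the second projection. [folklore] -/
theorem bal422a : ∀ x : ZMod 4 × ZMod 2 × ZMod 2,
    (Finset.univ.filter fun h : ZMod 4 × ZMod 2 × ZMod 2 =>
      ((AddMonoidHom.fst (ZMod 2) (ZMod 2)).comp (AddMonoidHom.snd (ZMod 4) (ZMod 2 × ZMod 2))) h =
        ((AddMonoidHom.fst (ZMod 2) (ZMod 2)).comp (AddMonoidHom.snd (ZMod 4) (ZMod 2 × ZMod 2))) x ∧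
      h ∈ ({(0,0,0), (1,0,0), (2,0,0), (0,0,1), (3,1,0), (1,1,1), (2,1,1), (3,1,1)} :
        Finset (ZMod 4 × ZMod 2 × ZMod 2))).card =
    (Finset.univ.filter fun h : ZMod 4 × ZMod 2 × ZMod 2 =>
      ((AddMonoidHom.fst (ZMod 2) (ZMod 2)).comp (AddMonoidHom.snd (ZMod 4) (ZMod 2 × ZMod 2))) h =
        ((AddMonoidHom.fst (ZMod 2) (ZMod 2)).comp (AddMonoidHom.snd (ZMod 4) (ZMod 2 × ZMod 2))) x ∧
      h ∉ ({(0,0,0), (1,0,0), (2,0,0), (0,0,1), (3,1,0), (1,1,1), (2,1,1), (3,1,1)} :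
        Finset (ZMod 4 × ZMod 2 × ZMod 2))).card := by
  decide

/-- `ℤ/4 × (ℤ/2)²`, `c₀ = (2,1,0)`: CM set. [folklore] -/
theorem cm422b : ∀ x : ZMod 4 × ZMod 2 × ZMod 2,
    x ∈ ({(0,0,0), (1,0,0), (2,0,0), (0,0,1), (1,1,0), (3,1,1), (0,1,1), (1,1,1)} :
      Finset (ZMod 4 × ZMod 2 × ZMod 2)) ↔
      (2, 1, 0) + x ∉ ({(0,0,0), (1,0,0), (2,0,0), (0,0,1), (1,1,0), (3,1,1), (0,1,1), (1,1,1)} :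
      Finset (ZMod 4 × ZMod 2 × ZMod 2)) := by
  decide

/-- `ℤ/4 × (ℤ/2)²`, `c₀ = (2,1,0)`: trivial stabiliser. [folklore] -/
theorem prim422b : ∀ v : ZMod 4 × ZMod 2 × ZMod 2, v ≠ 0 → ∃ w : ZMod 4 × ZMod 2 × ZMod 2,
    ¬ (w ∈ ({(0,0,0), (1,0,0), (2,0,0), (0,0,1), (1,1,0), (3,1,1), (0,1,1), (1,1,1)} :
      Finset (ZMod 4 × ZMod 2 × ZMod 2)) ↔
      v + w ∈ ({(0,0,0), (1,0,0), (2,0,0), (0,0,1), (1,1,0), (3,1,1), (0,1,1), (1,1,1)} :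
      Finset (ZMod 4 × ZMod 2 × ZMod 2))) := by
  decide

/-- `ℤ/4 × (ℤ/2)²`, `c₀ = (2,1,0)`: balanced `(4,4)` over the fibres of the second projection. [folklore] -/
theorem bal422b : ∀ x : ZMod 4 × ZMod 2 × ZMod 2,
    (Finset.univ.filter fun h : ZMod 4 × ZMod 2 × ZMod 2 =>
      ((AddMonoidHom.fst (ZMod 2) (ZMod 2)).comp (AddMonoidHom.snd (ZMod 4) (ZMod 2 × ZMod 2))) h =
        ((AddMonoidHom.fst (ZMod 2) (ZMod 2)).comp (AddMonoidHom.snd (ZMod 4) (ZMod 2 × ZMod 2))) x ∧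
      h ∈ ({(0,0,0), (1,0,0), (2,0,0), (0,0,1), (1,1,0), (3,1,1), (0,1,1), (1,1,1)} :
        Finset (ZMod 4 × ZMod 2 × ZMod 2))).card =
    (Finset.univ.filter fun h : ZMod 4 × ZMod 2 × ZMod 2 =>
      ((AddMonoidHom.fst (ZMod 2) (ZMod 2)).comp (AddMonoidHom.snd (ZMod 4) (ZMod 2 × ZMod 2))) h =
        ((AddMonoidHom.fst (ZMod 2) (ZMod 2)).comp (AddMonoidHom.snd (ZMod 4) (ZMod 2 × ZMod 2))) x ∧
      h ∉ ({(0,0,0), (1,0,0), (2,0,0), (0,0,1), (1,1,0), (3,1,1), (0,1,1), (1,1,1)} :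
        Finset (ZMod 4 × ZMod 2 × ZMod 2))).card := by
  decide

end Models

/-! ## §3 Simple degenerate CM eightfolds for the three remaining Galois types -/

section Field

variable [IsGalois ℚ K]

omit [IsGalois ℚ K] in
/-- Realisation: a primitive degenerate type gives a SIMPLE abelian variety of dimension `[K:ℚ]/2` with an
exceptional Hodge class on some power (Shimura's existence theorem = tree `cmAbelianVarietyRealised_holds`;
simplicity = primitivity; Hazama/Pohlmann `exists_exceptional_pow_of_not_isNondegenerate`).
[cite: Shimura1998, §6.2 Thm. 3 and §8.2 Prop. 26] [cite: Gordon1999HodgeAVSurvey, Thm. 6.4] -/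
theorem exists_simple_exceptional_of_isPrimitive_not_isNondegenerate (Φ : CMType K) (φ₀ : K →+* ℂ)
    (hprim : IsPrimitive (ℂ ≃+* ℂ) Φ.1 φ₀) (hdeg : ¬ IsNondegenerate Φ) :
    ∃ (A : AbelianVariety ℂ) (ι : 𝓞 K →+* End A) (θ : K →+* Module.End ℂ (complexBetti A.X 1)),
      IsCMTypeRealisation Φ A ι θ ∧ A.IsSimple ∧ A.dim = Module.finrank ℚ K / 2 ∧
      ∃ n m : ℕ, ∃ x : complexBetti (⨁ fun _ : Fin n => A).X (2 * m), IsRationalClass x ∧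
        IsOfHodgeType (⨁ fun _ : Fin n => A).dim (⨁ fun _ : Fin n => A).X (2 * m) m m x ∧
        x ∉ divisorClassesSpan (⨁ fun _ : Fin n => A).X (⨁ fun _ : Fin n => A).dim m := by
  obtain ⟨A, ι, θ, hA, hs, hdim⟩ := exists_simple_realisation_of_isPrimitive Φ φ₀ hprim
  exact ⟨A, ι, θ, hA, hs, hdim, exists_exceptional_pow_of_not_isNondegenerate φ₀ hprim hdeg hA⟩

/-- **`Gal(K/ℚ) ≅ ℤ/4 × ℤ/4`** (complex conjugation `(2,0)`; up to automorphism the only position): `K` has a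
PRIMITIVE DEGENERATE CM type — balanced `(2,2,2,2)` over the cyclic quartic CM subfield fixed by `0 × ℤ/4` — realised
by a simple degenerate CM abelian EIGHTFOLD. [cite: Gordon1999HodgeAVSurvey, §9.4.3 (Theorem [B.140])]
[cite: Shimura1998, §6.2 Thm. 3 and §8.2 Prop. 26] -/
theorem exists_simple_degenerate_of_equiv_zmod4_sq (e : (K ≃ₐ[ℚ] K) ≃* Multiplicative (ZMod 4 × ZMod 4))
    (hc : e ((IsCMField.complexConj K).restrictScalars ℚ) = Multiplicative.ofAdd (2, 0)) (φ₀ : K →+* ℂ) :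
    ∃ (Φ : CMType K) (A : AbelianVariety ℂ) (ι : 𝓞 K →+* End A) (θ : K →+* Module.End ℂ (complexBetti A.X 1)),
      IsPrimitive (ℂ ≃+* ℂ) Φ.1 φ₀ ∧ ¬ IsNondegenerate Φ ∧ IsCMTypeRealisation Φ A ι θ ∧ A.IsSimple ∧ A.dim = 8 := by
  have hK : Module.finrank ℚ K = 16 := by rw [finrank_eq_card_of_equiv e]; simp [ZMod.card]
  obtain ⟨Φ, hprim, hdeg⟩ := exists_isPrimitive_not_isNondegenerate_of_balancedModel e (2, 0) hc _ Models.cm44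
    Models.prim44 (AddMonoidHom.fst (ZMod 4) (ZMod 4)) (by decide) Models.bal44 φ₀
  obtain ⟨A, ι, θ, hA, hs, hdim, -⟩ := exists_simple_exceptional_of_isPrimitive_not_isNondegenerate Φ φ₀ hprim hdeg
  exact ⟨Φ, A, ι, θ, hprim, hdeg, hA, hs, by rw [hdim, hK]⟩

/-- **`Gal(K/ℚ) ≅ ℤ/4 × (ℤ/2)²` with complex conjugation `(0,1,0)`** (`K = K₄⁺ · k · …`: cyclic real quartic times
imaginary quadratic times real quadratic; e.g. `ℚ(ζ₄₀)`-type positions): a PRIMITIVE DEGENERATE CM type of Weil type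
`(4,4)` over the imaginary quadratic subfield fixed by `{y = 0}`, realised by a simple degenerate CM eightfold.
[cite: Gordon1999HodgeAVSurvey, §9.4.3 (Theorem [B.140])] [cite: Shimura1998, §6.2 Thm. 3 and §8.2 Prop. 26] -/
theorem exists_simple_degenerate_of_equiv_zmod4_prod_zmod2_sq_conj_snd
    (e : (K ≃ₐ[ℚ] K) ≃* Multiplicative (ZMod 4 × ZMod 2 × ZMod 2))
    (hc : e ((IsCMField.complexConj K).restrictScalars ℚ) = Multiplicative.ofAdd (0, 1, 0)) (φ₀ : K →+* ℂ) :
    ∃ (Φ : CMType K) (A : AbelianVariety ℂ) (ι : 𝓞 K →+* End A) (θ : K →+* Module.End ℂ (complexBetti A.X 1)),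
      IsPrimitive (ℂ ≃+* ℂ) Φ.1 φ₀ ∧ ¬ IsNondegenerate Φ ∧ IsCMTypeRealisation Φ A ι θ ∧ A.IsSimple ∧ A.dim = 8 := by
  have hK : Module.finrank ℚ K = 16 := by rw [finrank_eq_card_of_equiv e]; simp [ZMod.card]
  obtain ⟨Φ, hprim, hdeg⟩ := exists_isPrimitive_not_isNondegenerate_of_balancedModel e (0, 1, 0) hc _
    Models.cm422a Models.prim422a
    ((AddMonoidHom.fst (ZMod 2) (ZMod 2)).comp (AddMonoidHom.snd (ZMod 4) (ZMod 2 × ZMod 2))) (by decide)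
    Models.bal422a φ₀
  obtain ⟨A, ι, θ, hA, hs, hdim, -⟩ := exists_simple_exceptional_of_isPrimitive_not_isNondegenerate Φ φ₀ hprim hdeg
  exact ⟨Φ, A, ι, θ, hprim, hdeg, hA, hs, by rw [hdim, hK]⟩

/-- **`Gal(K/ℚ) ≅ ℤ/4 × (ℤ/2)²` with complex conjugation `(2,1,0)`** (not a square, not in a direct factor `ℤ/2`;
e.g. `ℚ(ζ₄₀)`, `ℚ(ζ₄₈)`, `ℚ(ζ₆₀)`): a PRIMITIVE DEGENERATE CM type of Weil type `(4,4)` over the imaginary quadratic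
subfield fixed by `{y = 0}`, realised by a simple degenerate CM eightfold. [cite: Gordon1999HodgeAVSurvey, §9.4.2,
§9.4.3 (Theorem [B.140])] [cite: Shimura1998, §6.2 Thm. 3 and §8.2 Prop. 26] -/
theorem exists_simple_degenerate_of_equiv_zmod4_prod_zmod2_sq_conj_mixed
    (e : (K ≃ₐ[ℚ] K) ≃* Multiplicative (ZMod 4 × ZMod 2 × ZMod 2))
    (hc : e ((IsCMField.complexConj K).restrictScalars ℚ) = Multiplicative.ofAdd (2, 1, 0)) (φ₀ : K →+* ℂ) :
    ∃ (Φ : CMType K) (A : AbelianVariety ℂ) (ι : 𝓞 K →+* End A) (θ : K →+* Module.End ℂ (complexBetti A.X 1)),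
      IsPrimitive (ℂ ≃+* ℂ) Φ.1 φ₀ ∧ ¬ IsNondegenerate Φ ∧ IsCMTypeRealisation Φ A ι θ ∧ A.IsSimple ∧ A.dim = 8 := by
  have hK : Module.finrank ℚ K = 16 := by rw [finrank_eq_card_of_equiv e]; simp [ZMod.card]
  obtain ⟨Φ, hprim, hdeg⟩ := exists_isPrimitive_not_isNondegenerate_of_balancedModel e (2, 1, 0) hc _
    Models.cm422b Models.prim422b
    ((AddMonoidHom.fst (ZMod 2) (ZMod 2)).comp (AddMonoidHom.snd (ZMod 4) (ZMod 2 × ZMod 2))) (by decide)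
    Models.bal422b φ₀
  obtain ⟨A, ι, θ, hA, hs, hdim, -⟩ := exists_simple_exceptional_of_isPrimitive_not_isNondegenerate Φ φ₀ hprim hdeg
  exact ⟨Φ, A, ι, θ, hprim, hdeg, hA, hs, by rw [hdim, hK]⟩

end Field

end Summit.HodgeConjecture.CorCM.AbelianSixteen

end
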